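import Mathlib
import Literature.Analysis.FluidPDE.VectorCalculus
import Summits.NavierStokesRegularity.NavierStokesRegularity.Theorems.ThreadingFluxHorizonTowerCubicCert
import Summits.NavierStokesRegularity.NavierStokesRegularity.Theorems.ThreadingFluxHorizonTowerZonalForm
import HarnessLib

/-!
# Crux `PoloidalLiouville` (stmt-NavierStokesRegularity-1222, wall W1), crux idea «horizon-threading-tower» (ns-idea-15):
# the l = 3 certificate core COMPOSED — the 28 forms vanish ⇒ `H_a` has the zonal functional form on `ℝ³`

HONEST LABEL (ns-wall-crit-1 AMENDED WORD 2026-08-28T20:06:03Z, option (A)).  Certificate core of the l = 3 cell of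
`HorizonTower.HorizonZonalitySingleDegree`, NOT that statement by name: the link «`𝔏₂[U_{H_a}] ≡ 0` off the origin ⇒ the 28 forms
`CubicCert.gens a` vanish» (identification step) is ENGINE-certified only (DATUM B-ht1, cell ns-wall-extremal).  What this file adds to
`ThreadingFluxHorizonTowerCubicCert.lean` (axis form) and `ThreadingFluxHorizonTowerZonalForm.lean` (generic bridge) is the `ℝ³`-level
composition for the explicit harmonic cubic `cubicHE3 a : E3 → ℝ`, `p ↦ cubicH a (p 0) (p 1) (p 2)`:

* `cubicHE3_line` / `hasDerivAt_cubicHE3_line` / `fderiv_cubicHE3_apply` / `inner_gradient_cubicHE3` — the written-out polynomials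
  `dHx/dHy/dHz` ARE the gradient of `cubicHE3 a` (via the exact Taylor identity `cubicH_taylor` of the data file: the restriction to a
  line is an explicit cubic in the parameter), and `inner_cross_gradient_cubicHE3`: `⟪n × p, ∇H_a(p)⟫ = n₀·rotFormX + n₁·rotFormY + n₂·rotFormZ`;
* ★ `zonalForm_of_gensVanish` — `(∀ j, gens a j = 0) → ∃ (n : E3) (g : ℝ → ℝ), n ≠ 0 ∧ ∀ y ≠ 0, cubicHE3 a y = ‖y‖ ^ 3 * g (⟪n, y⟫ / ‖y‖)`,
  i.e. EXACTLY the conclusion of `HorizonZonalitySingleDegree` (with `l = 3`, `H = cubicHE3 a`) from the 28 coefficient equations —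
  slice-free, no rotation-equivariance of `curl` anywhere.

WHAT REMAINS for the by-name l = 3 theorem (not here, sized L by ARM A): (i) a smooth `H` with `H (c • y) = c³ H y` and `ΔH = 0` is
`cubicHE3 a` for some `a`; (ii) `‖x‖⁶ · horizonL2 (horizonProfile 3 (cubicHE3 a) 0) 0 x = horizonNumerator a (x 0) (x 1) (x 2)`; (iii) hence
`(∀ x ≠ 0, horizonL2 … x = 0) → ∀ j, gens a j = 0` (28 distinct monomials).  Information-grade for W1/W2 (movement 0); `PoloidalLiouville`
(1222) and NS regularity OPEN and untouched.  Seat ns-wall-eng-7 g3; `--supports stmt-NavierStokesRegularity-1222 --as helper`.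
-/

-- the summit and its single problem share the name (D-0017 nested layout)
set_option linter.dupNamespace false

noncomputable section

open scoped RealInnerProductSpace
open Literature.Analysis.FluidPDE (cross)

namespace Summit.NavierStokesRegularity.NavierStokesRegularity.Theorems.PoloidalLiouville.HorizonTower.CubicCert

/-- `H_a` as a function on `ℝ³`: `p ↦ cubicH a (p 0) (p 1) (p 2)`. -/
def cubicHE3 (a : Fin 7 → ℝ) : E3 → ℝ := fun p => cubicH a (p 0) (p 1) (p 2)

/-- Half the Hessian of `H_a` at `(x,y,z)` as a quadratic form in `(u,v,w)` — the second-order term of `cubicH_taylor`, written out. -/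
def taylorQuad (a : Fin 7 → ℝ) (x y z u v w : ℝ) : ℝ :=
  -(6 * x * a 0 * u * w) - 3 * x * a 1 * u ^ (2 : ℕ) - x * a 1 * v ^ (2 : ℕ) + 4 * x * a 1 * w ^ (2 : ℕ) - 2 * x * a 2 * u * v
    + 2 * x * a 3 * u * w + x * a 4 * v * w + 3 * x * a 5 * u ^ (2 : ℕ) - 3 * x * a 5 * v ^ (2 : ℕ) + 6 * x * a 6 * u * v
    - 6 * y * a 0 * v * w - 2 * y * a 1 * u * v - y * a 2 * u ^ (2 : ℕ) - 3 * y * a 2 * v ^ (2 : ℕ) + 4 * y * a 2 * w ^ (2 : ℕ)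
    - 2 * y * a 3 * v * w + y * a 4 * u * w - 6 * y * a 5 * u * v + 3 * y * a 6 * u ^ (2 : ℕ) - 3 * y * a 6 * v ^ (2 : ℕ)
    - 3 * z * a 0 * u ^ (2 : ℕ) - 3 * z * a 0 * v ^ (2 : ℕ) + 6 * z * a 0 * w ^ (2 : ℕ) + 8 * z * a 1 * u * w + 8 * z * a 2 * v * w
    + z * a 3 * u ^ (2 : ℕ) - z * a 3 * v ^ (2 : ℕ) + z * a 4 * u * v

/-- `taylorQuad` is quadratic in `(u,v,w)`. -/
theorem taylorQuad_smul (a : Fin 7 → ℝ) (x y z u v w t : ℝ) :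
    taylorQuad a x y z (t * u) (t * v) (t * w) = t ^ 2 * taylorQuad a x y z u v w := by
  unfold taylorQuad
  ring

/-- `cubicH` is a cubic form: `H_a(t p) = t³ H_a(p)`. -/
theorem cubicH_smul (a : Fin 7 → ℝ) (x y z t : ℝ) : cubicH a (t * x) (t * y) (t * z) = t ^ 3 * cubicH a x y z := by
  unfold cubicH
  ring

/-- The exact Taylor expansion of the data file with the quadratic term named. -/
theorem cubicH_taylor' (a : Fin 7 → ℝ) (x y z u v w : ℝ) : cubicH a (x + u) (y + v) (z + w)
    = cubicH a x y z + (u * dHx a x y z + v * dHy a x y z + w * dHz a x y z) + taylorQuad a x y z u v w + cubicH a u v w := by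
  unfold taylorQuad
  exact cubicH_taylor a x y z u v w

/-- Restriction of `H_a` to the line `p + t v`: an explicit cubic polynomial in `t`. -/
theorem cubicHE3_line (a : Fin 7 → ℝ) (p v : E3) (t : ℝ) : cubicHE3 a (p + t • v)
    = cubicHE3 a p + t * (v 0 * dHx a (p 0) (p 1) (p 2) + v 1 * dHy a (p 0) (p 1) (p 2) + v 2 * dHz a (p 0) (p 1) (p 2))
      + t ^ 2 * taylorQuad a (p 0) (p 1) (p 2) (v 0) (v 1) (v 2) + t ^ 3 * cubicHE3 a v := by
  simp only [cubicHE3, PiLp.add_apply, PiLp.smul_apply, smul_eq_mul]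
  rw [cubicH_taylor', taylorQuad_smul, cubicH_smul]
  ring

/-- Directional derivative of `H_a` at `p` along `v`: `Σᵢ vᵢ ∂ᵢH_a(p)` with the written-out partials. -/
theorem hasDerivAt_cubicHE3_line (a : Fin 7 → ℝ) (p v : E3) :
    HasDerivAt (fun t : ℝ => cubicHE3 a (p + t • v))
      (v 0 * dHx a (p 0) (p 1) (p 2) + v 1 * dHy a (p 0) (p 1) (p 2) + v 2 * dHz a (p 0) (p 1) (p 2)) 0 := by
  have h : HasDerivAt (fun t : ℝ => cubicHE3 a p
      + t * (v 0 * dHx a (p 0) (p 1) (p 2) + v 1 * dHy a (p 0) (p 1) (p 2) + v 2 * dHz a (p 0) (p 1) (p 2))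
      + t ^ 2 * taylorQuad a (p 0) (p 1) (p 2) (v 0) (v 1) (v 2) + t ^ 3 * cubicHE3 a v)
      (0 + 1 * (v 0 * dHx a (p 0) (p 1) (p 2) + v 1 * dHy a (p 0) (p 1) (p 2) + v 2 * dHz a (p 0) (p 1) (p 2))
        + ((2 : ℕ) * (0 : ℝ) ^ (2 - 1) * 1) * taylorQuad a (p 0) (p 1) (p 2) (v 0) (v 1) (v 2)
        + ((3 : ℕ) * (0 : ℝ) ^ (3 - 1) * 1) * cubicHE3 a v) 0 :=
    (((hasDerivAt_const (0 : ℝ) (cubicHE3 a p)).add ((hasDerivAt_id (0 : ℝ)).mul_const _)).add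
      (((hasDerivAt_id (0 : ℝ)).pow 2).mul_const _)).add (((hasDerivAt_id (0 : ℝ)).pow 3).mul_const _)
  have hfun : (fun t : ℝ => cubicHE3 a (p + t • v)) = fun t : ℝ => cubicHE3 a p
      + t * (v 0 * dHx a (p 0) (p 1) (p 2) + v 1 * dHy a (p 0) (p 1) (p 2) + v 2 * dHz a (p 0) (p 1) (p 2))
      + t ^ 2 * taylorQuad a (p 0) (p 1) (p 2) (v 0) (v 1) (v 2) + t ^ 3 * cubicHE3 a v := by
    funext t
    exact cubicHE3_line a p v t
  rw [hfun]
  convert h using 1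
  simp

/-- `H_a` is differentiable on `ℝ³` (a polynomial in the coordinates). -/
theorem differentiable_cubicHE3 (a : Fin 7 → ℝ) : Differentiable ℝ (cubicHE3 a) := by
  have hc : ∀ i : Fin 3, Differentiable ℝ fun p : E3 => p i := fun i => differentiable_euclidean.mp differentiable_id i
  have h0 := hc 0
  have h1 := hc 1
  have h2 := hc 2
  unfold cubicHE3 cubicH
  fun_prop

/-- The Fréchet derivative of `H_a` evaluated on `v` is the written-out directional derivative. -/
theorem fderiv_cubicHE3_apply (a : Fin 7 → ℝ) (p v : E3) : fderiv ℝ (cubicHE3 a) p v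
    = v 0 * dHx a (p 0) (p 1) (p 2) + v 1 * dHy a (p 0) (p 1) (p 2) + v 2 * dHz a (p 0) (p 1) (p 2) := by
  have hline : HasDerivAt (fun t : ℝ => p + t • v) v 0 := by
    simpa using ((hasDerivAt_id (0 : ℝ)).smul_const v).const_add p
  have h1 : HasDerivAt (cubicHE3 a ∘ fun t : ℝ => p + t • v) (fderiv ℝ (cubicHE3 a) p v) 0 := by
    have h := (differentiable_cubicHE3 a (p + (0 : ℝ) • v)).hasFDerivAt.comp_hasDerivAt (0 : ℝ) hline
    rw [zero_smul, add_zero] at h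
    exact h
  exact h1.unique (hasDerivAt_cubicHE3_line a p v)

/-- `⟪∇H_a(p), v⟫ = Σᵢ vᵢ ∂ᵢH_a(p)` with the written-out partials `dHx/dHy/dHz`. -/
theorem inner_gradient_cubicHE3 (a : Fin 7 → ℝ) (p v : E3) : ⟪gradient (cubicHE3 a) p, v⟫
    = v 0 * dHx a (p 0) (p 1) (p 2) + v 1 * dHy a (p 0) (p 1) (p 2) + v 2 * dHz a (p 0) (p 1) (p 2) := by
  rw [inner_gradient_eq_fderiv, fderiv_cubicHE3_apply]

/-- `⟪n × p, ∇H_a(p)⟫ = n₀·rotFormX + n₁·rotFormY + n₂·rotFormZ` — the kernel meaning of the rotation forms of the data file. -/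
theorem inner_cross_gradient_cubicHE3 (a : Fin 7 → ℝ) (n p : E3) : ⟪cross n p, gradient (cubicHE3 a) p⟫
    = n 0 * rotFormX a (p 0) (p 1) (p 2) + n 1 * rotFormY a (p 0) (p 1) (p 2) + n 2 * rotFormZ a (p 0) (p 1) (p 2) := by
  rw [real_inner_comm, inner_gradient_cubicHE3]
  obtain ⟨c0, c1, c2⟩ := cross_fin3 n p
  rw [c0, c1, c2]
  unfold rotFormX rotFormY rotFormZ
  ring

/-- `H_a` is homogeneous of degree three. -/
theorem cubicHE3_smul (a : Fin 7 → ℝ) (c : ℝ) (y : E3) : cubicHE3 a (c • y) = c ^ 3 * cubicHE3 a y := by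
  simp only [cubicHE3, PiLp.smul_apply, smul_eq_mul]
  exact cubicH_smul a (y 0) (y 1) (y 2) c

/-- ★ **Certificate core, zonal form (l = 3).**  If the 28 coefficient forms vanish at `a`, the harmonic cubic `H_a` has the zonal
functional form about some non-zero axis: `∃ n ≠ 0, ∃ g, ∀ y ≠ 0, H_a(y) = ‖y‖³ g(⟪n,y⟫/‖y‖)` — literally the conclusion of
`HorizonZonalitySingleDegree` for `l = 3`, `H = cubicHE3 a`.  Engine reading (DATUM B-ht1): «𝔏₂[U_H] ≡ 0 ⇒ H zonal» at l = 3. -/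
theorem zonalForm_of_gensVanish (a : Fin 7 → ℝ) (h : ∀ j : Fin 28, gens a j = 0) :
    ∃ (n : E3) (g : ℝ → ℝ), n ≠ 0 ∧ ∀ y : E3, y ≠ 0 → cubicHE3 a y = ‖y‖ ^ 3 * g (⟪n, y⟫ / ‖y‖) := by
  obtain ⟨m, hm, hrot⟩ := exists_axis_of_gensVanish a h
  have hn : (WithLp.toLp 2 m : E3) ≠ 0 := by
    intro h0
    exact hm ((WithLp.toLp_eq_zero 2).mp h0)
  have hrot' : ∀ p : E3, ⟪cross (WithLp.toLp 2 m) p, gradient (cubicHE3 a) p⟫ = 0 := by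
    intro p
    rw [inner_cross_gradient_cubicHE3]
    exact hrot (p 0) (p 1) (p 2)
  obtain ⟨g, hg⟩ := exists_zonalForm_of_inner_cross_gradient_eq_zero (l := 3) hn (differentiable_cubicHE3 a)
    (fun c y _ => cubicHE3_smul a c y) hrot'
  exact ⟨WithLp.toLp 2 m, g, hn, hg⟩

end Summit.NavierStokesRegularity.NavierStokesRegularity.Theorems.PoloidalLiouville.HorizonTower.CubicCert

end
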